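import Summits.Ventures.LatticeQCDFlow.Scoring.ChainScorerTauIntCLT
import Summits.Ventures.LatticeQCDFlow.Scoring.ChainLagProductGaussianLimit
import Summits.Ventures.LatticeQCDFlow.Scoring.MadrasSokalDataWindow
import Summits.Ventures.LatticeQCDFlow.Scoring.MadrasSokalCoverage

/-!
# AT THE SCORER'S OWN WINDOW, ON CHAIN DATA: the `τ_int` statistic scorer A/B prints for the output of a
# chain with a Doeblin power, read at the data-chosen Madras–Sokal window, obeys the fixed-window CLT,
# from EVERY initial law

HONEST FRAMING: exact (Metropolis-corrected) sampling algorithms for lattice gauge theory;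
figures of merit are autocorrelation/cost numbers at stated couplings and volumes; no
continuum-physics claim.

Venture `LatticeQCDFlow` (cell pub-lqcd), sub-topic `Scoring`; FANOUT row 16 (`su2-base`), GEN-9.
NEW WORK of the cell, not a published result; no definition; nothing is cited as a fact.  DOCKING of
GEN-9's fixed-window CLT for scorer A's statistic on chain data
(`Scoring/ChainScorerTauIntCLT.tendstoInDistribution_chain_scorer_tauIntWindow_of_nHit`) with GEN-8's
abstract data-chosen-window transfer (`Scoring/MadrasSokalDataWindow.tendstoInDistribution_tauHat_at_msWindow`:
a statistic read at a selector that is eventually the strict population window inherits the fixed-window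
law).  The consistency input `τ̂_N(W) → τ_W` (`1 ≤ W ≤ w`) is taken from the CLT family itself
(`tendstoInMeasure_of_clt_family`) with the concrete Gaussian limits of
`Scoring/ChainLagProductGaussianLimit` — so this file does not depend on GEN-8's
`ChainMadrasSokalDataWindow` (same conclusion `P_{μ₀}(Ŵ_N ≠ w) → 0`, obtained there from row 13's
growing-window consistency).

## Content (`κ` Markov, `π` invariant, `(nHit κ m)(z,·) ≥ ε ν` for all `z`, `ε ≠ 0`, `0 < m`; `|f| ≤ C`
## measurable, `f̄ = f − ∫ f dπ`, `C(t) = autocov κ π f̄ t`, `C(0) ≠ 0`; `τ_W = tauIntWindow (C(·)/C(0)) W`;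
## `c > 0`, `w` a STRICT Madras–Sokal window of `W ↦ τ_W`; `Ŵ_N` a measurable selector returning `w`
## whenever `w` is the MS window of the empirical curve `W ↦ tauIntWindow (rhoHat (f ∘ x) N) W` — scorer
## B's `msWindowSel c Wmax` for `w ≤ Wmax` (GEN-8 `MadrasSokalWindowSelector`); `μ₀` ANY initial law)

* `measurable_chain_tauIntWindow_rhoHat` — the empirical curve is measurable in the path;
* `chain_scorer_tauIntWindow_tendstoInMeasure_of_nHit` — `τ̂_N(W) → τ_W` in `P_{μ₀}`-measure, every `W`
  (from the CLT with the realised limit);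
* **`tendstoInDistribution_chain_scorer_tauIntWindow_at_msWindow_of_nHit`** — THE THEOREM:
  `√N (τ̂_N(Ŵ_N) − τ_{Ŵ_N}) ⇒ ⟪tauHatGrad w (C(t))_{t≤w}, Z⟫` under `P_{μ₀}`, for every `Z` with the
  prescribed Gaussian projections at window `w`; `…_fixedCentre` — the same with centring `τ_w`;
* **`chain_tendsto_measure_msWindowSel_ne_of_clt`** — `P_{μ₀}(Ŵ_N ≠ w) → 0`;
* **`chain_tendsto_measure_printedBar_of_nHit`** — ASYMPTOTIC COVERAGE OF THE PRINTED MADRAS–SOKAL BAR on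
  chain data: `P_{μ₀}{τ_W within z printed bars} → N(0, σ²_ℓ/((4W+2) τ_W²))([−z, z])` (row 13's plug-in
  lemma, GEN-7's `msScale`); `chain_nominal_le_printedBar_limit` — over-coverage iff `σ²_ℓ ≤ (4W+2) τ_W²`;
  **`chain_tendsto_measure_printedBar_at_msWindow_of_nHit`** — the same coverage limit for window,
  estimate and bar ALL read at the scorer's data-chosen window.

NOT CLAIMED: tangential crossings (GEN-8 `MadrasSokalTangentialWindow`: the law is then a mixture);
a consistent estimator of `σ²_ℓ` along the chain (honest studentisation); whether `σ²_ℓ ≤ (4W+2) τ_W²` holds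
for a given sampler; rates.
-/

noncomputable section

open MeasureTheory ProbabilityTheory Filter Finset Preorder WithLp Set
open scoped ENNReal Topology RealInnerProductSpace
open Summit.Ventures.LatticeQCDFlow.Exactness Summit.Ventures.LatticeQCDFlow.Exactness.GeneralNCMC

namespace Summit.Ventures.LatticeQCDFlow.Scoring

variable {S : Type*} [MeasurableSpace S]

section AtWindow

variable (κ : Kernel S S) [IsMarkovKernel κ] {π : Measure S} [IsProbabilityMeasure π]
  {ν : Measure S} [IsProbabilityMeasure ν] {ε : ℝ≥0∞} {m : ℕ}

omit [MeasurableSpace S] in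
/-- `rhoHat` of the observed path is the ratio of the centred estimators. -/
theorem rhoHat_chain_eq (f : S → ℝ) (N t : ℕ) (x : ℕ → S) :
    rhoHat (fun i => f (x i)) N t
      = acovHatC (fun (i : ℕ) (x : ℕ → S) => f (x i)) N t x
        / acovHatC (fun (i : ℕ) (x : ℕ → S) => f (x i)) N 0 x := by
  rw [rhoHat, acovHatC_chain_eq_gammaHat, acovHatC_chain_eq_gammaHat]

/-- **The empirical `τ_int` curve of the path is measurable**: `x ↦ tauIntWindow (rhoHat (f ∘ x) N) W`. -/
theorem measurable_chain_tauIntWindow_rhoHat {f : S → ℝ} (hf : Measurable f) (N W : ℕ) :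
    Measurable fun x : ℕ → S => tauIntWindow (rhoHat (fun i => f (x i)) N) W := by
  have hXm : ∀ i : ℕ, Measurable fun x : ℕ → S => f (x i) := fun i => hf.comp (measurable_pi_apply i)
  have hρ : ∀ t, Measurable fun x : ℕ → S => rhoHat (fun i => f (x i)) N t := fun t => by
    simp_rw [rhoHat_chain_eq]
    exact (measurable_acovHatC hXm N t).div (measurable_acovHatC hXm N 0)
  unfold tauIntWindow
  exact measurable_const.add (Finset.measurable_sum _ fun t _ => hρ (t + 1))

/-- **Consistency at every fixed window from the CLT**: `τ̂_N(W) → τ_W` in `P_{μ₀}`-measure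
(the `√N`-law with the realised Gaussian limit of `ChainLagProductGaussianLimit`, unscaled). -/
theorem chain_scorer_tauIntWindow_tendstoInMeasure_of_nHit (hπ : Kernel.Invariant κ π) (hε : ε ≠ 0)
    (hmin : ∀ z, ε • ν ≤ nHit κ m z) (hm : 0 < m) {f : S → ℝ} (hf : Measurable f) {C : ℝ}
    (hC : ∀ z, |f z| ≤ C) (hσ : autocov κ π (fun z => f z - ∫ z', f z' ∂π) 0 ≠ 0)
    (μ₀ : Measure S) [IsProbabilityMeasure μ₀]
    [IsProbabilityMeasure (Kernel.trajMeasure (X := fun _ : ℕ => S) μ₀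
        (fun n : ℕ => κ.comap (fun hh : (i : ↥(Finset.Iic n)) → S => hh ⟨n, Finset.mem_Iic.2 le_rfl⟩)
          (measurable_pi_apply _)))] (W : ℕ) :
    TendstoInMeasure (Kernel.trajMeasure (X := fun _ : ℕ => S) μ₀
        (fun n : ℕ => κ.comap (fun hh : (i : ↥(Finset.Iic n)) → S => hh ⟨n, Finset.mem_Iic.2 le_rfl⟩)
          (measurable_pi_apply _)))
      (fun (N : ℕ) (x : ℕ → S) => tauIntWindow (rhoHat (fun i => f (x i)) N) W) atTop
      (fun _ => tauIntWindow (fun t => autocov κ π (fun z => f z - ∫ z', f z' ∂π) t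
        / autocov κ π (fun z => f z - ∫ z', f z' ∂π) 0) W) := by
  obtain ⟨hgm, hgC, -⟩ := centred_observable_bounds π hf hC
  obtain ⟨hZm, hZ⟩ := chain_gaussianLimit_realised κ W hπ hε hmin hm hgm hgC
  have hclt := tendstoInDistribution_chain_scorer_tauIntWindow_of_nHit κ hπ hε hmin hm hf hC W hσ μ₀ hZm hZ
  exact CardConsistency.tendstoInMeasure_of_tendstoInDistribution_scaled
    (Real.tendsto_sqrt_atTop.comp tendsto_natCast_atTop_atTop) hclt

/-- **THE FIXED-WINDOW LAW AT THE SCORER'S OWN WINDOW, ON CHAIN DATA, FROM ANY INITIAL LAW.**  With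
`τ̂_N(W) = tauIntWindow (rhoHat (f ∘ x) N) W`, `τ_W = tauIntWindow (C(·)/C(0)) W`, `w` a strict MS window
of `W ↦ τ_W` at `c > 0`, `Ŵ_N` a measurable selector returning `w` whenever `w` is the MS window of
`W ↦ τ̂_N(W)`, and `Z` a random vector of `ℝ^{w+1}` with the prescribed Gaussian projections:
`√N (τ̂_N(Ŵ_N) − τ_{Ŵ_N}) ⇒ ⟪tauHatGrad w (C(t))_{t≤w}, Z⟫` under `P_{μ₀}`. -/
theorem tendstoInDistribution_chain_scorer_tauIntWindow_at_msWindow_of_nHit (hπ : Kernel.Invariant κ π)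
    (hε : ε ≠ 0) (hmin : ∀ z, ε • ν ≤ nHit κ m z) (hm : 0 < m)
    {f : S → ℝ} (hf : Measurable f) {C : ℝ} (hC : ∀ z, |f z| ≤ C)
    (hσ : autocov κ π (fun z => f z - ∫ z', f z' ∂π) 0 ≠ 0) {c : ℝ} (hc : 0 < c) {w : ℕ}
    (hw : IsStrictMSWindow c (fun W => tauIntWindow (fun t => autocov κ π (fun z => f z - ∫ z', f z' ∂π) t
      / autocov κ π (fun z => f z - ∫ z', f z' ∂π) 0) W) w)
    {Wsel : ℕ → (ℕ → S) → ℕ} (hWm : ∀ N, Measurable (Wsel N))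
    (hsel : ∀ N x, IsMSWindow c (fun W => tauIntWindow (rhoHat (fun i => f (x i)) N) W) w → Wsel N x = w)
    (μ₀ : Measure S) [IsProbabilityMeasure μ₀]
    {Ω' : Type*} [MeasurableSpace Ω'] {P' : Measure Ω'} [IsProbabilityMeasure P']
    {Z : Ω' → EuclideanSpace ℝ (Fin (w + 1))} (hZm : AEMeasurable Z P')
    (hZ : ∀ a : EuclideanSpace ℝ (Fin (w + 1)), HasLaw (fun ω' => ⟪a, Z ω'⟫)
      (gaussianReal 0 (windowLRVar κ π w (lagProdComb (fun z => f z - ∫ z', f z' ∂π) w a)).toNNReal) P')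
    [IsProbabilityMeasure (Kernel.trajMeasure (X := fun _ : ℕ => S) μ₀
        (fun n : ℕ => κ.comap (fun hh : (i : ↥(Finset.Iic n)) → S => hh ⟨n, Finset.mem_Iic.2 le_rfl⟩)
          (measurable_pi_apply _)))] :
    TendstoInDistribution
      (fun (N : ℕ) (x : ℕ → S) => Real.sqrt N
        * (tauIntWindow (rhoHat (fun i => f (x i)) N) (Wsel N x)
          - tauIntWindow (fun t => autocov κ π (fun z => f z - ∫ z', f z' ∂π) t
              / autocov κ π (fun z => f z - ∫ z', f z' ∂π) 0) (Wsel N x)))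
      atTop (fun ω' => ⟪tauHatGrad w (toLp 2 fun t : Fin (w + 1) =>
        autocov κ π (fun z => f z - ∫ z', f z' ∂π) t), Z ω'⟫)
      (fun _ => Kernel.trajMeasure (X := fun _ : ℕ => S) μ₀
        (fun n : ℕ => κ.comap (fun hh : (i : ↥(Finset.Iic n)) → S => hh ⟨n, Finset.mem_Iic.2 le_rfl⟩)
          (measurable_pi_apply _))) P' :=
  tendstoInDistribution_tauHat_at_msWindow
    (τhat := fun (N W : ℕ) (x : ℕ → S) => tauIntWindow (rhoHat (fun i => f (x i)) N) W)
    (τW := fun W => tauIntWindow (fun t => autocov κ π (fun z => f z - ∫ z', f z' ∂π) t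
      / autocov κ π (fun z => f z - ∫ z', f z' ∂π) 0) W)
    (tendstoInDistribution_chain_scorer_tauIntWindow_of_nHit κ hπ hε hmin hm hf hC w hσ μ₀ hZm hZ)
    (fun N W => measurable_chain_tauIntWindow_rhoHat hf N W) hWm hc hw
    (fun W _ _ => chain_scorer_tauIntWindow_tendstoInMeasure_of_nHit κ hπ hε hmin hm hf hC hσ μ₀ W) hsel

/-- The same with the FIXED centring `τ_w`: `√N (τ̂_N(Ŵ_N) − τ_w) ⇒ ⟪ℓ, Z⟫` under `P_{μ₀}`. -/
theorem tendstoInDistribution_chain_scorer_tauIntWindow_at_msWindow_fixedCentre_of_nHit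
    (hπ : Kernel.Invariant κ π) (hε : ε ≠ 0) (hmin : ∀ z, ε • ν ≤ nHit κ m z) (hm : 0 < m)
    {f : S → ℝ} (hf : Measurable f) {C : ℝ} (hC : ∀ z, |f z| ≤ C)
    (hσ : autocov κ π (fun z => f z - ∫ z', f z' ∂π) 0 ≠ 0) {c : ℝ} (hc : 0 < c) {w : ℕ}
    (hw : IsStrictMSWindow c (fun W => tauIntWindow (fun t => autocov κ π (fun z => f z - ∫ z', f z' ∂π) t
      / autocov κ π (fun z => f z - ∫ z', f z' ∂π) 0) W) w)
    {Wsel : ℕ → (ℕ → S) → ℕ} (hWm : ∀ N, Measurable (Wsel N))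
    (hsel : ∀ N x, IsMSWindow c (fun W => tauIntWindow (rhoHat (fun i => f (x i)) N) W) w → Wsel N x = w)
    (μ₀ : Measure S) [IsProbabilityMeasure μ₀]
    {Ω' : Type*} [MeasurableSpace Ω'] {P' : Measure Ω'} [IsProbabilityMeasure P']
    {Z : Ω' → EuclideanSpace ℝ (Fin (w + 1))} (hZm : AEMeasurable Z P')
    (hZ : ∀ a : EuclideanSpace ℝ (Fin (w + 1)), HasLaw (fun ω' => ⟪a, Z ω'⟫)
      (gaussianReal 0 (windowLRVar κ π w (lagProdComb (fun z => f z - ∫ z', f z' ∂π) w a)).toNNReal) P')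
    [IsProbabilityMeasure (Kernel.trajMeasure (X := fun _ : ℕ => S) μ₀
        (fun n : ℕ => κ.comap (fun hh : (i : ↥(Finset.Iic n)) → S => hh ⟨n, Finset.mem_Iic.2 le_rfl⟩)
          (measurable_pi_apply _)))] :
    TendstoInDistribution
      (fun (N : ℕ) (x : ℕ → S) => Real.sqrt N
        * (tauIntWindow (rhoHat (fun i => f (x i)) N) (Wsel N x)
          - tauIntWindow (fun t => autocov κ π (fun z => f z - ∫ z', f z' ∂π) t
              / autocov κ π (fun z => f z - ∫ z', f z' ∂π) 0) w))
      atTop (fun ω' => ⟪tauHatGrad w (toLp 2 fun t : Fin (w + 1) =>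
        autocov κ π (fun z => f z - ∫ z', f z' ∂π) t), Z ω'⟫)
      (fun _ => Kernel.trajMeasure (X := fun _ : ℕ => S) μ₀
        (fun n : ℕ => κ.comap (fun hh : (i : ↥(Finset.Iic n)) → S => hh ⟨n, Finset.mem_Iic.2 le_rfl⟩)
          (measurable_pi_apply _))) P' :=
  tendstoInDistribution_tauHat_at_msWindow_fixedCentre
    (τhat := fun (N W : ℕ) (x : ℕ → S) => tauIntWindow (rhoHat (fun i => f (x i)) N) W)
    (τW := fun W => tauIntWindow (fun t => autocov κ π (fun z => f z - ∫ z', f z' ∂π) t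
      / autocov κ π (fun z => f z - ∫ z', f z' ∂π) 0) W)
    (tendstoInDistribution_chain_scorer_tauIntWindow_of_nHit κ hπ hε hmin hm hf hC w hσ μ₀ hZm hZ)
    (fun N W => measurable_chain_tauIntWindow_rhoHat hf N W) hWm hc hw
    (fun W _ _ => chain_scorer_tauIntWindow_tendstoInMeasure_of_nHit κ hπ hε hmin hm hf hC hσ μ₀ W) hsel

/-- **THE SCORER'S WINDOW ON CHAIN OUTPUT IS EVENTUALLY THE POPULATION WINDOW** (from the CLT family;
GEN-8's `ChainMadrasSokalDataWindow` reaches the same conclusion from row 13's consistency):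
`P_{μ₀}(Ŵ_N ≠ w) → 0`. -/
theorem chain_tendsto_measure_msWindowSel_ne_of_clt (hπ : Kernel.Invariant κ π) (hε : ε ≠ 0)
    (hmin : ∀ z, ε • ν ≤ nHit κ m z) (hm : 0 < m) {f : S → ℝ} (hf : Measurable f) {C : ℝ}
    (hC : ∀ z, |f z| ≤ C) (hσ : autocov κ π (fun z => f z - ∫ z', f z' ∂π) 0 ≠ 0) {c : ℝ} (hc : 0 < c)
    {w : ℕ} (hw : IsStrictMSWindow c (fun W => tauIntWindow (fun t =>
      autocov κ π (fun z => f z - ∫ z', f z' ∂π) t / autocov κ π (fun z => f z - ∫ z', f z' ∂π) 0) W) w)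
    {Wsel : ℕ → (ℕ → S) → ℕ}
    (hsel : ∀ N x, IsMSWindow c (fun W => tauIntWindow (rhoHat (fun i => f (x i)) N) W) w → Wsel N x = w)
    (μ₀ : Measure S) [IsProbabilityMeasure μ₀]
    [IsProbabilityMeasure (Kernel.trajMeasure (X := fun _ : ℕ => S) μ₀
        (fun n : ℕ => κ.comap (fun hh : (i : ↥(Finset.Iic n)) → S => hh ⟨n, Finset.mem_Iic.2 le_rfl⟩)
          (measurable_pi_apply _)))] :
    Tendsto (fun N : ℕ => (Kernel.trajMeasure (X := fun _ : ℕ => S) μ₀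
        (fun n : ℕ => κ.comap (fun hh : (i : ↥(Finset.Iic n)) → S => hh ⟨n, Finset.mem_Iic.2 le_rfl⟩)
          (measurable_pi_apply _))) {x | Wsel N x ≠ w}) atTop (𝓝 0) :=
  tendsto_measure_msWindowSel_ne
    (τhat := fun (N W : ℕ) (x : ℕ → S) => tauIntWindow (rhoHat (fun i => f (x i)) N) W) hc hw
    (fun W _ _ => chain_scorer_tauIntWindow_tendstoInMeasure_of_nHit κ hπ hε hmin hm hf hC hσ μ₀ W) hsel

/-! ## The printed Madras–Sokal bar on chain data: asymptotic coverage -/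

/-- **THE ASYMPTOTIC COVERAGE OF THE PRINTED BAR ON CHAIN DATA, FROM ANY INITIAL LAW.**  With
`τ̂_N(W) = tauIntWindow (rhoHat (f ∘ x) N) W`, `τ_W ≠ 0`, `B = msScale W` (GEN-7: `B(τ) = (|τ| √(4W+2))⁻¹`,
so that `|√N (τ̂ − τ_W) B(τ̂)| ≤ z` is the event '`τ_W` within `z` PRINTED bars `δτ_B = τ̂ √((4W+2)/N)`'),
and `σ²_ℓ = windowLRVar κ π W (lagProdComb f̄ W ℓ)` the CLT variance: for every `z > 0`,
`P_{μ₀}{|√N (τ̂_N(W) − τ_W) B(τ̂_N(W))| ≤ z} → N(0, σ²_ℓ/((4W+2) τ_W²))([−z, z])` (row 13's plug-in lemma). -/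
theorem chain_tendsto_measure_printedBar_of_nHit (hπ : Kernel.Invariant κ π) (hε : ε ≠ 0)
    (hmin : ∀ z, ε • ν ≤ nHit κ m z) (hm : 0 < m) {f : S → ℝ} (hf : Measurable f) {C : ℝ}
    (hC : ∀ z, |f z| ≤ C) (W : ℕ) (hσ : autocov κ π (fun z => f z - ∫ z', f z' ∂π) 0 ≠ 0)
    (hτ : tauIntWindow (fun t => autocov κ π (fun z => f z - ∫ z', f z' ∂π) t
        / autocov κ π (fun z => f z - ∫ z', f z' ∂π) 0) W ≠ 0)
    (μ₀ : Measure S) [IsProbabilityMeasure μ₀]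
    {Ω' : Type*} [MeasurableSpace Ω'] {P' : Measure Ω'} [IsProbabilityMeasure P']
    {Z : Ω' → EuclideanSpace ℝ (Fin (W + 1))} (hZm : AEMeasurable Z P')
    (hZ : ∀ a : EuclideanSpace ℝ (Fin (W + 1)), HasLaw (fun ω' => ⟪a, Z ω'⟫)
      (gaussianReal 0 (windowLRVar κ π W (lagProdComb (fun z => f z - ∫ z', f z' ∂π) W a)).toNNReal) P')
    [IsProbabilityMeasure (Kernel.trajMeasure (X := fun _ : ℕ => S) μ₀
        (fun n : ℕ => κ.comap (fun hh : (i : ↥(Finset.Iic n)) → S => hh ⟨n, Finset.mem_Iic.2 le_rfl⟩)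
          (measurable_pi_apply _)))] {z : ℝ} (hz : 0 < z) :
    Tendsto (fun N : ℕ => (Kernel.trajMeasure (X := fun _ : ℕ => S) μ₀
        (fun n : ℕ => κ.comap (fun hh : (i : ↥(Finset.Iic n)) → S => hh ⟨n, Finset.mem_Iic.2 le_rfl⟩)
          (measurable_pi_apply _))) {x | |Real.sqrt N
        * (tauIntWindow (rhoHat (fun i => f (x i)) N) W
          - tauIntWindow (fun t => autocov κ π (fun z => f z - ∫ z', f z' ∂π) t
              / autocov κ π (fun z => f z - ∫ z', f z' ∂π) 0) W)
        * msScale W (tauIntWindow (rhoHat (fun i => f (x i)) N) W)| ≤ z}) atTop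
      (𝓝 (gaussianReal 0 (NNReal.mk (msScale W (tauIntWindow (fun t =>
          autocov κ π (fun z => f z - ∫ z', f z' ∂π) t
            / autocov κ π (fun z => f z - ∫ z', f z' ∂π) 0) W) ^ 2) (sq_nonneg _)
        * (windowLRVar κ π W (lagProdComb (fun z => f z - ∫ z', f z' ∂π) W
            (tauHatGrad W (toLp 2 fun t : Fin (W + 1) =>
              autocov κ π (fun z => f z - ∫ z', f z' ∂π) t)))).toNNReal) (Icc (-z) z))) := by
  have hclt := tendstoInDistribution_chain_scorer_tauIntWindow_of_nHit κ hπ hε hmin hm hf hC W hσ μ₀ hZm hZ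
  have hlaw := hasLaw_chain_tauIntWindow_limit κ hZ (toLp 2 fun t : Fin (W + 1) =>
    autocov κ π (fun z => f z - ∫ z', f z' ∂π) t)
  have hcons := chain_scorer_tauIntWindow_tendstoInMeasure_of_nHit κ hπ hε hmin hm hf hC hσ μ₀ W
  have hB := CardConsistency.tendstoInMeasure_comp_continuousAt hcons (continuousAt_msScale W hτ)
  have hBm : ∀ N : ℕ, Measurable fun x : ℕ → S =>
      msScale W (tauIntWindow (rhoHat (fun i => f (x i)) N) W) :=
    fun N => (measurable_msScale W).comp (measurable_chain_tauIntWindow_rhoHat hf N W)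
  exact Exactness.GeneralNCMC.tendsto_measure_abs_mul_le_of_clt_of_tendstoInMeasure hBm hlaw hclt hB hz

/-- **Over-coverage criterion on chain data**: if `σ²_ℓ ≤ (4W+2) τ_W²` then the limiting coverage of
the printed `±z δτ_B` interval is at least the nominal `N(0,1)([−z, z])` (GEN-7's
`nominal_le_printedBar_limit`; `σ²_ℓ ≥ 0` by `windowLRVar_nonneg_of_nHit`). -/
theorem chain_nominal_le_printedBar_limit (hπ : Kernel.Invariant κ π) (hε : ε ≠ 0)
    (hmin : ∀ z, ε • ν ≤ nHit κ m z) (hm : 0 < m) {f : S → ℝ} (hf : Measurable f) {C : ℝ}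
    (hC : ∀ z, |f z| ≤ C) (W : ℕ)
    (hτ : tauIntWindow (fun t => autocov κ π (fun z => f z - ∫ z', f z' ∂π) t
        / autocov κ π (fun z => f z - ∫ z', f z' ∂π) 0) W ≠ 0)
    (hR : windowLRVar κ π W (lagProdComb (fun z => f z - ∫ z', f z' ∂π) W
        (tauHatGrad W (toLp 2 fun t : Fin (W + 1) => autocov κ π (fun z => f z - ∫ z', f z' ∂π) t)))
      ≤ (4 * W + 2) * (tauIntWindow (fun t => autocov κ π (fun z => f z - ∫ z', f z' ∂π) t
        / autocov κ π (fun z => f z - ∫ z', f z' ∂π) 0) W) ^ 2) {z : ℝ} (hz : 0 ≤ z) :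
    gaussianReal 0 1 (Icc (-z) z)
      ≤ gaussianReal 0 (NNReal.mk (msScale W (tauIntWindow (fun t =>
          autocov κ π (fun z => f z - ∫ z', f z' ∂π) t
            / autocov κ π (fun z => f z - ∫ z', f z' ∂π) 0) W) ^ 2) (sq_nonneg _)
        * (windowLRVar κ π W (lagProdComb (fun z => f z - ∫ z', f z' ∂π) W
            (tauHatGrad W (toLp 2 fun t : Fin (W + 1) =>
              autocov κ π (fun z => f z - ∫ z', f z' ∂π) t)))).toNNReal) (Icc (-z) z) := by
  obtain ⟨hgm, hgC, -⟩ := centred_observable_bounds π hf hC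
  exact nominal_le_printedBar_limit W hτ
    (windowLRVar_nonneg_of_nHit κ W hπ hε hmin hm (measurable_lagProdComb hgm W _)
      (abs_lagProdComb_le hgC W _)) hR hz

/-- **THE PRINTED BAR AT THE SCORER'S OWN WINDOW, ON CHAIN DATA**: under the hypotheses of
`tendstoInDistribution_chain_scorer_tauIntWindow_at_msWindow_of_nHit` (strict population window `w` at
`c > 0`, admissible measurable selector `Ŵ_N`) and `τ_w ≠ 0`, the coverage probability of the event
'`τ_{Ŵ_N}` within `z` printed bars of `τ̂_N(Ŵ_N)`' — window, estimate and bar all read at the data-chosen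
window — has the window-`w` limit `N(0, σ²_ℓ/((4w+2) τ_w²))([−z, z])` (GEN-8's `tendsto_measure_at_msWindow`). -/
theorem chain_tendsto_measure_printedBar_at_msWindow_of_nHit (hπ : Kernel.Invariant κ π) (hε : ε ≠ 0)
    (hmin : ∀ z, ε • ν ≤ nHit κ m z) (hm : 0 < m) {f : S → ℝ} (hf : Measurable f) {C : ℝ}
    (hC : ∀ z, |f z| ≤ C) (hσ : autocov κ π (fun z => f z - ∫ z', f z' ∂π) 0 ≠ 0) {c : ℝ} (hc : 0 < c)
    {w : ℕ} (hw : IsStrictMSWindow c (fun W => tauIntWindow (fun t =>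
      autocov κ π (fun z => f z - ∫ z', f z' ∂π) t / autocov κ π (fun z => f z - ∫ z', f z' ∂π) 0) W) w)
    (hτ : tauIntWindow (fun t => autocov κ π (fun z => f z - ∫ z', f z' ∂π) t
        / autocov κ π (fun z => f z - ∫ z', f z' ∂π) 0) w ≠ 0)
    {Wsel : ℕ → (ℕ → S) → ℕ}
    (hsel : ∀ N x, IsMSWindow c (fun W => tauIntWindow (rhoHat (fun i => f (x i)) N) W) w → Wsel N x = w)
    (μ₀ : Measure S) [IsProbabilityMeasure μ₀]
    {Ω' : Type*} [MeasurableSpace Ω'] {P' : Measure Ω'} [IsProbabilityMeasure P']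
    {Z : Ω' → EuclideanSpace ℝ (Fin (w + 1))} (hZm : AEMeasurable Z P')
    (hZ : ∀ a : EuclideanSpace ℝ (Fin (w + 1)), HasLaw (fun ω' => ⟪a, Z ω'⟫)
      (gaussianReal 0 (windowLRVar κ π w (lagProdComb (fun z => f z - ∫ z', f z' ∂π) w a)).toNNReal) P')
    [IsProbabilityMeasure (Kernel.trajMeasure (X := fun _ : ℕ => S) μ₀
        (fun n : ℕ => κ.comap (fun hh : (i : ↥(Finset.Iic n)) → S => hh ⟨n, Finset.mem_Iic.2 le_rfl⟩)
          (measurable_pi_apply _)))] {z : ℝ} (hz : 0 < z) :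
    Tendsto (fun N : ℕ => (Kernel.trajMeasure (X := fun _ : ℕ => S) μ₀
        (fun n : ℕ => κ.comap (fun hh : (i : ↥(Finset.Iic n)) → S => hh ⟨n, Finset.mem_Iic.2 le_rfl⟩)
          (measurable_pi_apply _))) {x | |Real.sqrt N
        * (tauIntWindow (rhoHat (fun i => f (x i)) N) (Wsel N x)
          - tauIntWindow (fun t => autocov κ π (fun z => f z - ∫ z', f z' ∂π) t
              / autocov κ π (fun z => f z - ∫ z', f z' ∂π) 0) (Wsel N x))
        * msScale (Wsel N x) (tauIntWindow (rhoHat (fun i => f (x i)) N) (Wsel N x))| ≤ z}) atTop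
      (𝓝 (gaussianReal 0 (NNReal.mk (msScale w (tauIntWindow (fun t =>
          autocov κ π (fun z => f z - ∫ z', f z' ∂π) t
            / autocov κ π (fun z => f z - ∫ z', f z' ∂π) 0) w) ^ 2) (sq_nonneg _)
        * (windowLRVar κ π w (lagProdComb (fun z => f z - ∫ z', f z' ∂π) w
            (tauHatGrad w (toLp 2 fun t : Fin (w + 1) =>
              autocov κ π (fun z => f z - ∫ z', f z' ∂π) t)))).toNNReal) (Icc (-z) z))) :=
  tendsto_measure_at_msWindow
    (A := fun (N W : ℕ) => {x : ℕ → S | |Real.sqrt N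
        * (tauIntWindow (rhoHat (fun i => f (x i)) N) W
          - tauIntWindow (fun t => autocov κ π (fun z => f z - ∫ z', f z' ∂π) t
              / autocov κ π (fun z => f z - ∫ z', f z' ∂π) 0) W)
        * msScale W (tauIntWindow (rhoHat (fun i => f (x i)) N) W)| ≤ z})
    (τhat := fun (N W : ℕ) (x : ℕ → S) => tauIntWindow (rhoHat (fun i => f (x i)) N) W)
    (chain_tendsto_measure_printedBar_of_nHit κ hπ hε hmin hm hf hC w hσ hτ μ₀ hZm hZ hz) hc hw
    (fun W _ _ => chain_scorer_tauIntWindow_tendstoInMeasure_of_nHit κ hπ hε hmin hm hf hC hσ μ₀ W) hsel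

end AtWindow

end Summit.Ventures.LatticeQCDFlow.Scoring

end
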